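import Mathlib
import Summits.MatrixMultiplication.MatrixMultiplication.Theses.FidelityWitnesses
import Summits.MatrixMultiplication.MatrixMultiplication.Theorems.FidelityThesis.Negative.SummitEquivalence
import Summits.MatrixMultiplication.MatrixMultiplication.Theorems.FidelityWitnessesDiagonalPowerDecayGlue
import Summits.MatrixMultiplication.MatrixMultiplication.Theorems.FidelityWitnessesDiagonalPowerDecayStubNonnegFlatDecayTightness
import Literature.Computability.AlgebraicComplexity.MatMulMonomialSubrank
import Literature.Computability.AlgebraicComplexity.TensorMultiples
import Literature.Computability.AlgebraicComplexity.TensorRestrictionRank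

/-!
# The point law `M(n,n²) ≤ n^{6/ω(ℂ)}`: equivalence with the capture law, meaning, consequences (core file)

Line `vertex-flattening-factor-rank` for the crux `FidelityWitnesses.DiagonalPowerDecay`
(`stmt-MatrixMultiplication-14053`), lead c2.  The landed file `…DiagonalPowerDecayExactnessIJ.lean` showed that the line's
open ω-free stub `stub_exactnessIJ` is the CAPTURE LAW `M(n,n²) ≤ C_ε n^{6/ω+ε}` (p107930).  Here the tensor-power trick removes both
the constant and the `ε` (fidelity is multiplicative and the rank budget `n²` is stable under Kronecker powers
`S ↦ S^{⊠L}` read in the `n^L × n^L` format):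

* `pointLaw_iff_captureLaw` — the capture law (`∀ε ∃C ∀n≥1 ∀S, R(S) ≤ n² → |⟨S,T⟩|² ≤ C n^{6/ω+ε}‖S‖²`, which is
  `stub_exactnessIJ` by `exactnessIJ_iff_captureLaw`, …ExactnessIJ.lean) is equivalent to the **POINT LAW**
  `∀ n S, R(S) ≤ n² → |⟨S,⟨n,n,n⟩⟩|² ≤ n^{6/ω(ℂ)}·‖S‖²` (no constant, no `ε`, every `n`): `M(n,n²) ≤ n^{6/ω}`.
  (The one-line corollary `exactnessIJ_iff_pointLaw` is in the companion file …PointLaw.lean, which imports …ExactnessIJ.lean.)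
* `omega_le_of_pointLaw` — its meaning: **an L²-ROBUST SCHÖNHAGE–BINI THEOREM at budget `n²`** — every rank-`≤ n²` tensor
  `S` with fidelity `f = |⟨S,T⟩|²/‖S‖² > 1` against `⟨n,n,n⟩` (`n ≥ 2`) certifies `ω(ℂ) ≤ 6·log n / log f`, exactly the
  bound an EXACT algorithm computing `f` of the `n³` products with `n²` multiplications would give (Schönhage: `f^{ω/3} ≤ n²`).
* `dpd_of_pointLaw_of_two_lt_omega` (the crux with the SHARP exponent `2δ = 3 − 6/ω` and constant `1`),
  `dpd_iff_fidelityThesis_of_pointLaw`, `matrixMultiplication_or_dpd_of_pointLaw`.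

So the crux chain's residue, in one line: **is `M(n,n²) ≤ n^{6/ω}`?** (`≥ m³` for the largest `⟨m,m,m⟩` of rank `≤ n²` always;
`= n³` trivially if `ω = 2`; for `ω > 2` it is the crux at its sharp exponent).
Mathlib + landed Theorems (SummitEquivalence, Glue, NonnegFlatTightness real-analysis lemmas) + Literature (`kroneckerPow`,
`tensorRank_kroneckerPow_le`, `matMulTensor_pow_eq_kroneckerPow_comp`, `tensorRestrictsTo_precomp`) only; no definitions
(the `n^L × n^L`-format tensor power is a local term).
-/

set_option linter.dupNamespace false

namespace Summit.MatrixMultiplication.MatrixMultiplication.Theorems.DiagonalPowerDecay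

open scoped BigOperators
open Literature.Computability.AlgebraicComplexity
open Summit.MatrixMultiplication.MatrixMultiplication.Theses.FidelityWitnesses (DiagonalPowerDecay FidelityThesis)

/-! ## Kronecker powers in the `n^L × n^L` format (local terms, no definitions) -/

/-- The un-flattening bijection `[n^L]×[n^L] ≃ ([n]×[n])^L` used to read a tensor power in the square format. [folklore] -/
theorem pl_exists_equiv (n L : ℕ) :
    ∃ e : (Fin (n ^ L) × Fin (n ^ L)) ≃ (Fin L → Fin n × Fin n),
      ∀ a, e a = fun i => ((finFunctionFinEquiv.symm a.1) i, (finFunctionFinEquiv.symm a.2) i) :=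
  ⟨{ toFun := fun a i => ((finFunctionFinEquiv.symm a.1) i, (finFunctionFinEquiv.symm a.2) i)
     invFun := fun x => (finFunctionFinEquiv (fun i => (x i).1), finFunctionFinEquiv (fun i => (x i).2))
     left_inv := fun a => by simp
     right_inv := fun x => by funext i; simp }, fun _ => rfl⟩

/-- **Core identity**: for any `g` on `([n]×[n])³`,
`Σ_{a,b,c ∈ [n^L]²} ∏_i g (ψa i) (ψb i) (ψc i) = (Σ_{u,v,w} g u v w)^L` (`ψ` the un-flattening bijection). [folklore] -/
theorem pl_sum_prod_eq_pow {R : Type*} [CommSemiring R] (n L : ℕ)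
    (g : (Fin n × Fin n) → (Fin n × Fin n) → (Fin n × Fin n) → R) :
    (∑ a : Fin (n ^ L) × Fin (n ^ L), ∑ b : Fin (n ^ L) × Fin (n ^ L), ∑ c : Fin (n ^ L) × Fin (n ^ L),
      ∏ i : Fin L,
        g ((finFunctionFinEquiv.symm a.1) i, (finFunctionFinEquiv.symm a.2) i)
          ((finFunctionFinEquiv.symm b.1) i, (finFunctionFinEquiv.symm b.2) i)
          ((finFunctionFinEquiv.symm c.1) i, (finFunctionFinEquiv.symm c.2) i)) =
      (∑ u, ∑ v, ∑ w, g u v w) ^ L := by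
  obtain ⟨e, he⟩ := pl_exists_equiv n L
  -- reindex the three slots along `e`
  have step : (∑ a : Fin (n ^ L) × Fin (n ^ L), ∑ b : Fin (n ^ L) × Fin (n ^ L), ∑ c : Fin (n ^ L) × Fin (n ^ L),
      ∏ i : Fin L, g (e a i) (e b i) (e c i)) =
      ∑ x : Fin L → Fin n × Fin n, ∑ y : Fin L → Fin n × Fin n, ∑ z : Fin L → Fin n × Fin n,
        ∏ i : Fin L, g (x i) (y i) (z i) := by
    rw [← Equiv.sum_comp e]
    refine Finset.sum_congr rfl fun a _ => ?_
    rw [← Equiv.sum_comp e]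
    refine Finset.sum_congr rfl fun b _ => ?_
    exact Equiv.sum_comp e (fun z => ∏ i : Fin L, g (e a i) (e b i) (z i))
  have hLHS : (∑ a : Fin (n ^ L) × Fin (n ^ L), ∑ b : Fin (n ^ L) × Fin (n ^ L), ∑ c : Fin (n ^ L) × Fin (n ^ L),
      ∏ i : Fin L,
        g ((finFunctionFinEquiv.symm a.1) i, (finFunctionFinEquiv.symm a.2) i)
          ((finFunctionFinEquiv.symm b.1) i, (finFunctionFinEquiv.symm b.2) i)
          ((finFunctionFinEquiv.symm c.1) i, (finFunctionFinEquiv.symm c.2) i)) =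
      ∑ a : Fin (n ^ L) × Fin (n ^ L), ∑ b : Fin (n ^ L) × Fin (n ^ L), ∑ c : Fin (n ^ L) × Fin (n ^ L),
        ∏ i : Fin L, g (e a i) (e b i) (e c i) := by
    simp only [he]
  rw [hLHS, step]
  -- combine the three function slots into one function `p : Fin L → (P × P × P)`
  let E : (Fin L → (Fin n × Fin n) × (Fin n × Fin n) × (Fin n × Fin n)) ≃
      (Fin L → Fin n × Fin n) × (Fin L → Fin n × Fin n) × (Fin L → Fin n × Fin n) :=
    { toFun := fun p => (fun i => (p i).1, fun i => (p i).2.1, fun i => (p i).2.2)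
      invFun := fun q i => (q.1 i, q.2.1 i, q.2.2 i)
      left_inv := fun p => by funext i; simp
      right_inv := fun q => by simp }
  have hcomb : (∑ x : Fin L → Fin n × Fin n, ∑ y : Fin L → Fin n × Fin n, ∑ z : Fin L → Fin n × Fin n,
        ∏ i : Fin L, g (x i) (y i) (z i)) =
      ∑ p : Fin L → (Fin n × Fin n) × (Fin n × Fin n) × (Fin n × Fin n),
        ∏ i : Fin L, g (p i).1 (p i).2.1 (p i).2.2 := by
    have h1 : (∑ p : Fin L → (Fin n × Fin n) × (Fin n × Fin n) × (Fin n × Fin n),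
        ∏ i : Fin L, g (p i).1 (p i).2.1 (p i).2.2) =
        ∑ p : Fin L → (Fin n × Fin n) × (Fin n × Fin n) × (Fin n × Fin n),
          (fun q : (Fin L → Fin n × Fin n) × (Fin L → Fin n × Fin n) × (Fin L → Fin n × Fin n) =>
            ∏ i : Fin L, g (q.1 i) (q.2.1 i) (q.2.2 i)) (E p) := rfl
    rw [h1, Equiv.sum_comp E (fun q => ∏ i : Fin L, g (q.1 i) (q.2.1 i) (q.2.2 i))]
    simp only [Fintype.sum_prod_type]
  have hpow : (∑ p : Fin L → (Fin n × Fin n) × (Fin n × Fin n) × (Fin n × Fin n),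
        ∏ i : Fin L, g (p i).1 (p i).2.1 (p i).2.2) =
      (∑ w : (Fin n × Fin n) × (Fin n × Fin n) × (Fin n × Fin n), g w.1 w.2.1 w.2.2) ^ L :=
    (Fintype.sum_pow (fun w : (Fin n × Fin n) × (Fin n × Fin n) × (Fin n × Fin n) => g w.1 w.2.1 w.2.2) L).symm
  rw [hcomb, hpow]
  congr 1
  simp only [Fintype.sum_prod_type]

/-- **Overlaps multiply**: the `n^L × n^L`-format Kronecker power `S^{⊠L}` has
`⟨S^{⊠L}, ⟨n^L,n^L,n^L⟩⟩ = ⟨S, ⟨n,n,n⟩⟩^L` (`⟨n,n,n⟩^{⊗L} ≅ ⟨n^L,n^L,n^L⟩`, `matMulTensor_pow_eq_kroneckerPow_comp`). [folklore] -/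
theorem pl_overlap_pow (n L : ℕ) (S : (Fin n × Fin n) → (Fin n × Fin n) → (Fin n × Fin n) → ℂ) :
    (∑ a : Fin (n ^ L) × Fin (n ^ L), ∑ b : Fin (n ^ L) × Fin (n ^ L), ∑ c : Fin (n ^ L) × Fin (n ^ L),
      kroneckerPow S L
          (fun i => ((finFunctionFinEquiv.symm a.1) i, (finFunctionFinEquiv.symm a.2) i))
          (fun i => ((finFunctionFinEquiv.symm b.1) i, (finFunctionFinEquiv.symm b.2) i))
          (fun i => ((finFunctionFinEquiv.symm c.1) i, (finFunctionFinEquiv.symm c.2) i)) *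
        matMulTensor ℂ (n ^ L) (n ^ L) (n ^ L) a b c) =
      (∑ a, ∑ b, ∑ c, S a b c * matMulTensor ℂ n n n a b c) ^ L := by
  rw [matMulTensor_pow_eq_kroneckerPow_comp ℂ n n n L]
  simp only [kroneckerPow_apply, ← Finset.prod_mul_distrib]
  exact pl_sum_prod_eq_pow n L (fun u v w => S u v w * matMulTensor ℂ n n n u v w)

/-- **Norms multiply**: `‖S^{⊠L}‖² = (‖S‖²)^L`. [folklore] -/
theorem pl_normSq_pow (n L : ℕ) (S : (Fin n × Fin n) → (Fin n × Fin n) → (Fin n × Fin n) → ℂ) :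
    (∑ a : Fin (n ^ L) × Fin (n ^ L), ∑ b : Fin (n ^ L) × Fin (n ^ L), ∑ c : Fin (n ^ L) × Fin (n ^ L),
      ‖kroneckerPow S L
          (fun i => ((finFunctionFinEquiv.symm a.1) i, (finFunctionFinEquiv.symm a.2) i))
          (fun i => ((finFunctionFinEquiv.symm b.1) i, (finFunctionFinEquiv.symm b.2) i))
          (fun i => ((finFunctionFinEquiv.symm c.1) i, (finFunctionFinEquiv.symm c.2) i))‖ ^ 2) =
      (∑ a, ∑ b, ∑ c, ‖S a b c‖ ^ 2) ^ L := by
  simp only [kroneckerPow_apply, norm_prod, ← Finset.prod_pow]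
  exact pl_sum_prod_eq_pow n L (fun u v w => ‖S u v w‖ ^ 2)

/-- **Ranks are submultiplicative**: `R(S^{⊠L}) ≤ R(S)^L` in the `n^L × n^L` format (the format change is a relabelling,
hence a restriction, `tensorRestrictsTo_precomp`; then `tensorRank_kroneckerPow_le`). [folklore] -/
theorem pl_tensorRank_pow_le (n L : ℕ) (S : (Fin n × Fin n) → (Fin n × Fin n) → (Fin n × Fin n) → ℂ) :
    tensorRank (fun a b c : Fin (n ^ L) × Fin (n ^ L) =>
      kroneckerPow S L
          (fun i => ((finFunctionFinEquiv.symm a.1) i, (finFunctionFinEquiv.symm a.2) i))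
          (fun i => ((finFunctionFinEquiv.symm b.1) i, (finFunctionFinEquiv.symm b.2) i))
          (fun i => ((finFunctionFinEquiv.symm c.1) i, (finFunctionFinEquiv.symm c.2) i))) ≤
      tensorRank S ^ L := by
  classical
  have h1 := (tensorRestrictsTo_precomp (kroneckerPow S L)
    (fun a : Fin (n ^ L) × Fin (n ^ L) => fun i => ((finFunctionFinEquiv.symm a.1) i, (finFunctionFinEquiv.symm a.2) i))
    (fun b : Fin (n ^ L) × Fin (n ^ L) => fun i => ((finFunctionFinEquiv.symm b.1) i, (finFunctionFinEquiv.symm b.2) i))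
    (fun c : Fin (n ^ L) × Fin (n ^ L) => fun i =>
      ((finFunctionFinEquiv.symm c.1) i, (finFunctionFinEquiv.symm c.2) i))).tensorRank_le
  exact h1.trans (tensorRank_kroneckerPow_le S L)

/-! ## Point law ⟺ capture law ⟺ exactness principle -/

/-- **Capture law ⟹ point law** (tensor-power trick): if `|⟨S,T⟩|² > n^{6/ω}‖S‖²` for one `S` of rank `≤ n²` (`n ≥ 2`),
then the Kronecker powers `S^{⊠L}` (rank `≤ (n^L)²`, fidelity the `L`-th power) violate `M(N,N²) ≤ C_ε N^{6/ω+ε}` for a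
small `ε`. The cases `n ≤ 1` are Cauchy–Schwarz. [folklore] -/
theorem pointLaw_of_captureLaw
    (hL : ∀ ε : ℝ, 0 < ε → ∃ C : ℝ, 0 < C ∧ ∀ n : ℕ, 1 ≤ n →
      ∀ S : (Fin n × Fin n) → (Fin n × Fin n) → (Fin n × Fin n) → ℂ, tensorRank S ≤ n ^ 2 →
        ‖∑ a, ∑ b, ∑ c, S a b c * matMulTensor ℂ n n n a b c‖ ^ 2 ≤
          C * (n : ℝ) ^ (6 / omega ℂ + ε) * ∑ a, ∑ b, ∑ c, ‖S a b c‖ ^ 2) :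
    ∀ n : ℕ, ∀ S : (Fin n × Fin n) → (Fin n × Fin n) → (Fin n × Fin n) → ℂ, tensorRank S ≤ n ^ 2 →
      ‖∑ a, ∑ b, ∑ c, S a b c * matMulTensor ℂ n n n a b c‖ ^ 2 ≤
        (n : ℝ) ^ (6 / omega ℂ) * ∑ a, ∑ b, ∑ c, ‖S a b c‖ ^ 2 := by
  intro n S hS
  rcases Nat.lt_or_ge n 2 with hn | hn
  · -- `n ≤ 1`: for `n = 0` every sum is empty; for `n = 1` the point law is the identity `|S₀₀₀·1|² ≤ 1·|S₀₀₀|²`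
    -- (one index, `⟨1,1,1⟩ = 1`), computed by `simp`.
    have h01 : n = 0 ∨ n = 1 := by omega
    rcases h01 with rfl | rfl
    · simp
    · simp [Fintype.sum_prod_type, Finset.univ_unique, matMulTensor]
  · -- `n ≥ 2`
    set F := ‖∑ a, ∑ b, ∑ c, S a b c * matMulTensor ℂ n n n a b c‖ ^ 2 with hF
    set N := ∑ a, ∑ b, ∑ c, ‖S a b c‖ ^ 2 with hN
    have hN0 : 0 ≤ N := by positivity
    have hF0 : 0 ≤ F := by positivity
    have hn0 : (0 : ℝ) < n := by exact_mod_cast (by omega : 0 < n)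
    have hn1 : (1 : ℝ) < n := by exact_mod_cast hn
    set y : ℝ := (n : ℝ) ^ (6 / omega ℂ) with hy
    have hypos : 0 < y := Real.rpow_pos_of_pos hn0 _
    by_contra hcon
    rw [not_le] at hcon
    -- `N > 0` (else the capture law at `ε = 1` gives `F ≤ C·n^{…}·0 = 0`, contradicting `F > y·N = 0`)
    have hNpos : 0 < N := by
      rcases hN0.lt_or_eq with h | h
      · exact h
      · exfalso
        obtain ⟨C₁, _, hC₁⟩ := hL 1 one_pos
        have h1 : F ≤ C₁ * (n : ℝ) ^ (6 / omega ℂ + 1) * N := hC₁ n (by omega) S hS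
        rw [← h, mul_zero] at h1
        rw [← h, mul_zero] at hcon
        linarith
    -- the excess ratio `ρ = F/(y N) > 1` and `ε := logb n ρ / 2`, so that `n^ε = √ρ < ρ`
    set ρ : ℝ := F / (y * N) with hρ
    have hyN : 0 < y * N := mul_pos hypos hNpos
    have hρ1 : 1 < ρ := by rw [hρ, lt_div_iff₀ hyN]; linarith
    have hρ0 : 0 < ρ := by linarith
    set ε : ℝ := Real.logb n ρ / 2 with hε
    have hlogb : 0 < Real.logb n ρ := Real.logb_pos hn1 hρ1
    have hε0 : 0 < ε := by positivity
    have hnε : (n : ℝ) ^ ε = ρ ^ ((1 : ℝ) / 2) := by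
      rw [hε, show Real.logb n ρ / 2 = Real.logb n ρ * (1 / 2) by ring, Real.rpow_mul hn0.le,
        Real.rpow_logb hn0 hn1.ne' hρ0]
    have hnε_lt : (n : ℝ) ^ ε < ρ := by
      rw [hnε]
      calc ρ ^ ((1 : ℝ) / 2) < ρ ^ (1 : ℝ) := Real.rpow_lt_rpow_of_exponent_lt hρ1 (by norm_num)
        _ = ρ := Real.rpow_one ρ
    -- the capture law at `ε`, applied to the Kronecker powers of `S`
    obtain ⟨C, _, hLC⟩ := hL ε hε0
    have hk : ∀ L : ℕ, F ^ L ≤ C * ((n : ℝ) ^ (6 / omega ℂ + ε) * N) ^ L := by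
      intro L
      have hfmt : 1 ≤ n ^ L := Nat.one_le_pow _ _ (by omega)
      have hr : tensorRank (fun a b c : Fin (n ^ L) × Fin (n ^ L) =>
          kroneckerPow S L
            (fun i => ((finFunctionFinEquiv.symm a.1) i, (finFunctionFinEquiv.symm a.2) i))
            (fun i => ((finFunctionFinEquiv.symm b.1) i, (finFunctionFinEquiv.symm b.2) i))
            (fun i => ((finFunctionFinEquiv.symm c.1) i, (finFunctionFinEquiv.symm c.2) i))) ≤ (n ^ L) ^ 2 :=
        (pl_tensorRank_pow_le n L S).trans
          (by rw [← pow_mul, mul_comm, pow_mul]; exact Nat.pow_le_pow_left hS L)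
      have key := hLC (n ^ L) hfmt _ hr
      rw [pl_overlap_pow, pl_normSq_pow, norm_pow, ← pow_mul, mul_comm L 2, pow_mul] at key
      push_cast at key
      rw [NonnegFlatTightness.rpow_natPow_comm hn0.le] at key
      calc F ^ L ≤ C * ((n : ℝ) ^ (6 / omega ℂ + ε)) ^ L * N ^ L := key
        _ = C * ((n : ℝ) ^ (6 / omega ℂ + ε) * N) ^ L := by ring
    have hle : F ≤ (n : ℝ) ^ (6 / omega ℂ + ε) * N :=
      NonnegFlatTightness.le_of_pow_le_mul_pow (mul_pos (Real.rpow_pos_of_pos hn0 _) hNpos) hk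
    -- `F = ρ·y·N ≤ n^ε·y·N` forces `ρ ≤ n^ε < ρ`
    rw [Real.rpow_add hn0] at hle
    have hFeq : F = ρ * (y * N) := by rw [hρ, div_mul_cancel₀ _ hyN.ne']
    have : ρ * (y * N) ≤ (n : ℝ) ^ ε * (y * N) := by rw [← hFeq]; linarith [hle]
    have hρle : ρ ≤ (n : ℝ) ^ ε := le_of_mul_le_mul_right this hyN
    linarith

/-- **Point law ⟹ capture law** (`C = 1`; `n^{6/ω} ≤ n^{6/ω+ε}` for `n ≥ 1`). [folklore] -/
theorem captureLaw_of_pointLaw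
    (hP : ∀ n : ℕ, ∀ S : (Fin n × Fin n) → (Fin n × Fin n) → (Fin n × Fin n) → ℂ, tensorRank S ≤ n ^ 2 →
      ‖∑ a, ∑ b, ∑ c, S a b c * matMulTensor ℂ n n n a b c‖ ^ 2 ≤
        (n : ℝ) ^ (6 / omega ℂ) * ∑ a, ∑ b, ∑ c, ‖S a b c‖ ^ 2) :
    ∀ ε : ℝ, 0 < ε → ∃ C : ℝ, 0 < C ∧ ∀ n : ℕ, 1 ≤ n →
      ∀ S : (Fin n × Fin n) → (Fin n × Fin n) → (Fin n × Fin n) → ℂ, tensorRank S ≤ n ^ 2 →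
        ‖∑ a, ∑ b, ∑ c, S a b c * matMulTensor ℂ n n n a b c‖ ^ 2 ≤
          C * (n : ℝ) ^ (6 / omega ℂ + ε) * ∑ a, ∑ b, ∑ c, ‖S a b c‖ ^ 2 := by
  intro ε hε
  refine ⟨1, one_pos, fun n hn S hS => ?_⟩
  have hn1 : (1 : ℝ) ≤ n := by exact_mod_cast hn
  calc ‖∑ a, ∑ b, ∑ c, S a b c * matMulTensor ℂ n n n a b c‖ ^ 2
      ≤ (n : ℝ) ^ (6 / omega ℂ) * ∑ a, ∑ b, ∑ c, ‖S a b c‖ ^ 2 := hP n S hS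
    _ ≤ 1 * (n : ℝ) ^ (6 / omega ℂ + ε) * ∑ a, ∑ b, ∑ c, ‖S a b c‖ ^ 2 := by
        rw [one_mul]
        exact mul_le_mul_of_nonneg_right
          (Real.rpow_le_rpow_of_exponent_le hn1 (by linarith)) (by positivity)

/-- **Point law ⟺ capture law.** [folklore] -/
theorem pointLaw_iff_captureLaw :
    (∀ n : ℕ, ∀ S : (Fin n × Fin n) → (Fin n × Fin n) → (Fin n × Fin n) → ℂ, tensorRank S ≤ n ^ 2 →
      ‖∑ a, ∑ b, ∑ c, S a b c * matMulTensor ℂ n n n a b c‖ ^ 2 ≤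
        (n : ℝ) ^ (6 / omega ℂ) * ∑ a, ∑ b, ∑ c, ‖S a b c‖ ^ 2) ↔
    (∀ ε : ℝ, 0 < ε → ∃ C : ℝ, 0 < C ∧ ∀ n : ℕ, 1 ≤ n →
      ∀ S : (Fin n × Fin n) → (Fin n × Fin n) → (Fin n × Fin n) → ℂ, tensorRank S ≤ n ^ 2 →
        ‖∑ a, ∑ b, ∑ c, S a b c * matMulTensor ℂ n n n a b c‖ ^ 2 ≤
          C * (n : ℝ) ^ (6 / omega ℂ + ε) * ∑ a, ∑ b, ∑ c, ‖S a b c‖ ^ 2) :=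
  ⟨captureLaw_of_pointLaw, pointLaw_of_captureLaw⟩

/-! ## Meaning and consequences of the point law -/

/-- **L²-robust Schönhage–Bini at budget `n²`** (the meaning of the point law): under the law, every tensor `S` of rank
`≤ n²` (`n ≥ 2`) with fidelity `f = |⟨S,⟨n,n,n⟩⟩|²/‖S‖² > 1` certifies `ω(ℂ) ≤ 6·log n / log f` — as if `S` were an
exact algorithm computing `f` of the `n³` products (compare Schönhage: `f^{ω/3} ≤ R`). [folklore] -/
theorem omega_le_of_pointLaw
    (hP : ∀ n : ℕ, ∀ S : (Fin n × Fin n) → (Fin n × Fin n) → (Fin n × Fin n) → ℂ, tensorRank S ≤ n ^ 2 →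
      ‖∑ a, ∑ b, ∑ c, S a b c * matMulTensor ℂ n n n a b c‖ ^ 2 ≤
        (n : ℝ) ^ (6 / omega ℂ) * ∑ a, ∑ b, ∑ c, ‖S a b c‖ ^ 2)
    {n : ℕ} (hn : 2 ≤ n) (S : (Fin n × Fin n) → (Fin n × Fin n) → (Fin n × Fin n) → ℂ)
    (hS : tensorRank S ≤ n ^ 2)
    (hf : ∑ a, ∑ b, ∑ c, ‖S a b c‖ ^ 2 < ‖∑ a, ∑ b, ∑ c, S a b c * matMulTensor ℂ n n n a b c‖ ^ 2) :
    omega ℂ ≤ 6 * Real.log n /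
      Real.log (‖∑ a, ∑ b, ∑ c, S a b c * matMulTensor ℂ n n n a b c‖ ^ 2 / ∑ a, ∑ b, ∑ c, ‖S a b c‖ ^ 2) := by
  set F := ‖∑ a, ∑ b, ∑ c, S a b c * matMulTensor ℂ n n n a b c‖ ^ 2 with hF
  set N := ∑ a, ∑ b, ∑ c, ‖S a b c‖ ^ 2 with hN
  have hN0 : 0 ≤ N := by positivity
  have hNpos : 0 < N := by
    rcases hN0.lt_or_eq with h | h
    · exact h
    · exfalso
      have hPL : F ≤ (n : ℝ) ^ (6 / omega ℂ) * N := hP n S hS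
      rw [← h, mul_zero] at hPL
      rw [← h] at hf
      linarith
  have hn1 : (1 : ℝ) < n := by exact_mod_cast hn
  have hn0 : (0 : ℝ) < n := by linarith
  have hω0 : 0 < omega ℂ := by linarith [omega_two_le ℂ]
  have hratio : 1 < F / N := by rwa [one_lt_div hNpos]
  have hlogf : 0 < Real.log (F / N) := Real.log_pos hratio
  have hlogn : 0 < Real.log n := Real.log_pos hn1
  -- `F/N ≤ n^{6/ω}`, take logarithms
  have h1 : F / N ≤ (n : ℝ) ^ (6 / omega ℂ) := by
    rw [div_le_iff₀ hNpos]; exact hP n S hS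
  have h2 : Real.log (F / N) ≤ 6 / omega ℂ * Real.log n := by
    have := Real.log_le_log (by linarith) h1
    rwa [Real.log_rpow hn0] at this
  rw [le_div_iff₀ hlogf]
  have h3 : omega ℂ * Real.log (F / N) ≤ omega ℂ * (6 / omega ℂ * Real.log n) :=
    mul_le_mul_of_nonneg_left h2 hω0.le
  calc omega ℂ * Real.log (F / N) ≤ omega ℂ * (6 / omega ℂ * Real.log n) := h3
    _ = 6 * Real.log n := by field_simp

/-- **Point law ∧ `ω(ℂ) > 2` ⟹ the crux, with the SHARP exponent `2δ = 3 − 6/ω` and constant `1`.** [folklore] -/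
theorem dpd_of_pointLaw_of_two_lt_omega
    (hP : ∀ n : ℕ, ∀ S : (Fin n × Fin n) → (Fin n × Fin n) → (Fin n × Fin n) → ℂ, tensorRank S ≤ n ^ 2 →
      ‖∑ a, ∑ b, ∑ c, S a b c * matMulTensor ℂ n n n a b c‖ ^ 2 ≤
        (n : ℝ) ^ (6 / omega ℂ) * ∑ a, ∑ b, ∑ c, ‖S a b c‖ ^ 2)
    (hω : 2 < omega ℂ) : DiagonalPowerDecay := by
  have hωpos : 0 < omega ℂ := by linarith
  have hlt : 6 / omega ℂ < 3 := by
    rw [div_lt_iff₀ hωpos]; linarith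
  refine ⟨1, (3 - 6 / omega ℂ) / 2, by linarith, fun n S hS => ?_⟩
  have hexp : (3 : ℝ) - 2 * ((3 - 6 / omega ℂ) / 2) = 6 / omega ℂ := by ring
  rw [hexp, one_mul]
  exact hP n S hS

/-- **Under the point law, crux #5 `DiagonalPowerDecay` ⟺ target #0 `FidelityThesis`.** [folklore] -/
theorem dpd_iff_fidelityThesis_of_pointLaw
    (hP : ∀ n : ℕ, ∀ S : (Fin n × Fin n) → (Fin n × Fin n) → (Fin n × Fin n) → ℂ, tensorRank S ≤ n ^ 2 →
      ‖∑ a, ∑ b, ∑ c, S a b c * matMulTensor ℂ n n n a b c‖ ^ 2 ≤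
        (n : ℝ) ^ (6 / omega ℂ) * ∑ a, ∑ b, ∑ c, ‖S a b c‖ ^ 2) :
    DiagonalPowerDecay ↔ FidelityThesis :=
  ⟨fun hD => Summit.MatrixMultiplication.MatrixMultiplication.Theorems.diagonalPowerDecayGlue_proof hD,
    fun hX => dpd_of_pointLaw_of_two_lt_omega hP
      (Summit.MatrixMultiplication.MatrixMultiplication.Theorems.two_lt_omega_of_fidelityThesis hX)⟩

/-- **The point law implies `MatrixMultiplication ∨ DiagonalPowerDecay`** (and `MatrixMultiplication` implies the point law,
`pointLaw_of_omega_eq_two` in the companion file …PointLaw.lean): the law is sandwiched between the summit and "summit ∨ crux".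
[folklore] -/
theorem matrixMultiplication_or_dpd_of_pointLaw
    (hP : ∀ n : ℕ, ∀ S : (Fin n × Fin n) → (Fin n × Fin n) → (Fin n × Fin n) → ℂ, tensorRank S ≤ n ^ 2 →
      ‖∑ a, ∑ b, ∑ c, S a b c * matMulTensor ℂ n n n a b c‖ ^ 2 ≤
        (n : ℝ) ^ (6 / omega ℂ) * ∑ a, ∑ b, ∑ c, ‖S a b c‖ ^ 2) :
    _root_.MatrixMultiplication ∨ DiagonalPowerDecay := by
  by_cases hM : _root_.MatrixMultiplication
  · exact Or.inl hM
  · refine Or.inr (dpd_of_pointLaw_of_two_lt_omega hP ?_)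
    rw [_root_.MatrixMultiplication_iff] at hM
    exact lt_of_le_of_ne (omega_two_le ℂ) (Ne.symm hM)

end Summit.MatrixMultiplication.MatrixMultiplication.Theorems.DiagonalPowerDecay
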